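import Literature.Computability.Cryptography.Schemes
import Literature.Computability.Cryptography.OneWayFunctionsPneNP
import HarnessLib

/-!
# The scheme-existence hypotheses imply `P ≠ NP` (modulo Impagliazzo–Luby, Thm. 1)

Companion of `Schemes.lean` (crypto-foundations.S13/S23: `OWFExist_of_secureSKEExist`,
`OWFExist_of_bitCommitmentExist`, `OWFExist_of_secureSignaturesExist`) and of
`OneWayFunctionsPneNP.lean` (the one-way-function existence hypotheses imply Cook's `P ≠ NP`).

The three existence statements of the prelude —

* `SecureSKEExist` (`EncryptionSchemes.lean`): an efficient, correct private-key encryption scheme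
  with indistinguishable *multiple* encryptions exists (the Impagliazzo–Luby hypothesis form);
* `BitCommitmentExist` (`CommitmentsSignatures.lean`): an efficient, computationally hiding,
  statistically binding non-interactive bit commitment exists;
* `SecureSignaturesExist` (`CommitmentsSignatures.lean`): an EUF-CMA-secure signature scheme
  exists —

are **intractability assumptions, not theorems in print**. What the sources print about the
existence of secure private-key encryption is conditional and bidirectional: Goldreich,
*Foundations of Cryptography II* (2004), §5.3.3, **Theorem 5.3.11**: "If there exist
(non-uniformly strong) one-way functions, then there exist secure private-key encryption schemes"
(security "in the multiple-message setting", footnote 16), followed by "The converse holds too; see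
Exercise 2", and §5.5.7, **Exercise 2** ("Secure encryption schemes imply one-way function
[Impagliazzo–Luby 1989]: Show that the existence of a secure private-key encryption scheme …
implies the existence of one-way functions"); likewise Thm. 6.4.1 ("Secure signature schemes exist
if and only if one-way functions exist") and Impagliazzo–Luby 1989, Thm. 1 (private-key
encryption, bit commitment, identification ⇒ one-way functions). The existence of one-way
functions is itself only conjectured (Goldreich 2001, §1.1, §2.2.4, §1.5.3 "Open Problems"; see
the module docstring of `OneWayFunctionsPneNP.lean`).

This file records the consequence **inside the tree's models**: modulo the named facts of
`Schemes.lean` that vendor Impagliazzo–Luby's Theorem 1 (`OWFExist_of_secureSKEExist`,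
`OWFExist_of_bitCommitmentExist`) and its signature analogue (`OWFExist_of_secureSignaturesExist`),
each of the three hypotheses implies `OWFExist` and hence — by the tree's *proved*
`NP_not_subset_P_of_OWFExist`, `P_ne_NP_of_OWFExist_holds` (Goldreich 2001, §2.7.4 Exercise 2,
`CryptoFoundationsOneWayFunctionsProofs.lean`) and `pneNP_shape_of_OWFExist`
(`OneWayFunctionsPneNP.lean`) — Cook's `P ≠ NP` in the literal shape
`∃ L, L ∈ PNPWave0.NP Bool ∧ L ∉ PNPWave0.P Bool` of the registered summit statement. A discharge
`theorem SecureSKEExist_holds : SecureSKEExist` (or of either sibling) would therefore be, up to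
one published theorem, a Lean proof of `P ≠ NP`: these `Prop`s are open conjectures in the sense
of CONVENTIONS §4 and stay undischarged hypotheses `(h : SecureSKEExist)`, exactly like
`OWFExist`, `PRGExist`, `PRFExist`.

## Contents (assembly only; nothing is posited beyond the named facts taken as hypotheses)

* `OWFExist_iff_secureSKEExist_of` — Goldreich 2004, Thm. 5.3.11 together with "the converse
  holds too" (Exercise 2), as an equivalence modulo its two directions taken as hypotheses (the
  `⇐` direction, Thm. 5.3.11 proper, is not a tree fact and is therefore an explicit binder);
* `NP_not_subset_P_of_secureSKEExist_of`, `P_ne_NP_of_secureSKEExist_of`,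
  `pneNP_shape_of_secureSKEExist_of`;
* `NP_not_subset_P_of_bitCommitmentExist_of`, `pneNP_shape_of_bitCommitmentExist_of`;
* `NP_not_subset_P_of_secureSignaturesExist_of`, `pneNP_shape_of_secureSignaturesExist_of`.

## What is deliberately NOT here

* No new definition and no new named fact: Thm. 5.3.11 (`OWFExist →` secure private-key
  encryption) is not vendored (it would be a new unproved fact; its printed proof is
  Construction 5.3.9 over a non-uniformly pseudorandom function ensemble plus Prop. 5.3.8).
* No unconditional version. In the tree's model `NP ⊆ P → ¬ SecureSKEExist` is provable without
  Impagliazzo–Luby (exhaustive key search made polynomial by `exists_searchFn_of_NP_subset_P`,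
  `SearchToDecision.lean`, against `t ≥ L(n) + 2` distinct equal-length plaintexts, where `L` bounds
  the key length; a spurious key decrypts `t` independent encryptions of one plaintext to `t`
  distinct targets with probability `≤ t⁻ᵗ` — Shannon's unicity bound), but the polynomial-time
  verifier for "some padded key of length `L(n)+1` decrypts every component of the coded ciphertext
  list to the listed plaintext" has not been assembled from the `Brick` calculus yet; see the notes
  of the literature-prover unit for `SecureSKEExist`.

## References

* O. Goldreich, *Foundations of Cryptography II: Basic Applications*, CUP 2004: §5.3.3,
  Construction 5.3.9, Prop. 5.3.10, Thm. 5.3.11 (and the sentence after it); §5.5.5; §5.5.7,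
  Exercise 2; Thm. 6.4.1.
* R. Impagliazzo, M. Luby, *One-way functions are essential for complexity based cryptography*,
  FOCS 1989 (doi:10.1109/sfcs.1989.63483), Theorem 1.
* O. Goldreich, *Foundations of Cryptography I: Basic Tools*, CUP 2001: §1.1, §1.5.3, §2.2.4,
  §2.7.4 Exercise 2.
* J. Rompel, *One-way functions are necessary and sufficient for secure signatures*, STOC 1990, §1.
* S. Cook, *The P versus NP problem*, Clay Mathematics Institute problem description, §1.
-/

namespace Literature.Computability.Cryptography

open Complexity Complexity.Classes Complexity.Nondeterministic

/-! ### Private-key encryption (`SecureSKEExist`) -/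

/-- **Goldreich 2004, Thm. 5.3.11 with its converse, as an equivalence modulo its two directions.**
"If there exist (non-uniformly strong) one-way functions, then there exist secure private-key
encryption schemes. The converse holds too; see Exercise 2." The `⇒` direction of the `iff` below
(secure private-key encryption ⇒ one-way functions, Exercise 2 = Impagliazzo–Luby 1989, Thm. 1) is
the tree fact `OWFExist_of_secureSKEExist`; the `⇐` direction (Thm. 5.3.11 proper, via
Construction 5.3.9) is not a tree fact and enters as the explicit hypothesis `h₂`.
[cite: Goldreich2004, §5.3.3 Thm. 5.3.11 and §5.5.7 Exercise 2] -/
theorem OWFExist_iff_secureSKEExist_of (h₁ : OWFExist_of_secureSKEExist)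
    (h₂ : OWFExist → SecureSKEExist) : (OWFExist ↔ SecureSKEExist) :=
  ⟨h₂, fun h => h₁ h⟩

/-- **`SecureSKEExist` implies `NP ⊄ P`**, modulo the named fact `OWFExist_of_secureSKEExist`
(Impagliazzo–Luby 1989, Thm. 1; Goldreich 2004, §5.5.7 Exercise 2); the last step
`OWFExist → NP ⊄ P` is the tree's proved `NP_not_subset_P_of_OWFExist` (Goldreich 2001, §2.7.4,
Exercise 2). [cite: Goldreich2004, §5.5.7 Exercise 2] -/
theorem NP_not_subset_P_of_secureSKEExist_of (hIL : OWFExist_of_secureSKEExist)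
    (h : SecureSKEExist) : ¬ (NP ⊆ P) :=
  NP_not_subset_P_of_OWFExist (hIL h)

/-- **`SecureSKEExist` implies `P ≠ NP`**, modulo the named fact `OWFExist_of_secureSKEExist`;
the last step is the tree's proved `P_ne_NP_of_OWFExist_holds`. This is why `SecureSKEExist` is an
open conjecture kept as an undischarged hypothesis and no `SecureSKEExist_holds` can be landed
from the literature (Goldreich 2004, Thm. 5.3.11: existence is proved only from one-way
functions, whose existence is conjectural, Goldreich 2001, §2.2.4).
[cite: Goldreich2004, §5.5.7 Exercise 2] -/
theorem P_ne_NP_of_secureSKEExist_of (hIL : OWFExist_of_secureSKEExist) (h : SecureSKEExist) :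
    P ≠ NP :=
  P_ne_NP_of_OWFExist_holds (hIL h)

/-- **`SecureSKEExist` implies Cook's `P ≠ NP` in the shape of the registered summit statement**
(`∃ L, L ∈ PNPWave0.NP Bool ∧ L ∉ PNPWave0.P Bool`), modulo the named fact
`OWFExist_of_secureSKEExist` (Impagliazzo–Luby 1989, Thm. 1), via the tree's proved
`pneNP_shape_of_OWFExist`. [cite: Goldreich2004, §5.5.7 Exercise 2] -/
theorem pneNP_shape_of_secureSKEExist_of (hIL : OWFExist_of_secureSKEExist) (h : SecureSKEExist) :
    ∃ L : Language Bool, L ∈ Literature.Computability.Complexity.PNPWave0.NP Bool ∧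
      L ∉ Literature.Computability.Complexity.PNPWave0.P Bool :=
  pneNP_shape_of_OWFExist (hIL h)

/-! ### Bit commitment (`BitCommitmentExist`) -/

/-- **`BitCommitmentExist` implies `NP ⊄ P`**, modulo the named fact
`OWFExist_of_bitCommitmentExist` (Impagliazzo–Luby 1989, Thm. 1: bit commitment ⇒ one-way
functions), via the tree's proved `NP_not_subset_P_of_OWFExist`.
[cite: ImpagliazzoLuby1989, Thm. 1] -/
theorem NP_not_subset_P_of_bitCommitmentExist_of (hIL : OWFExist_of_bitCommitmentExist)
    (h : BitCommitmentExist) : ¬ (NP ⊆ P) :=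
  NP_not_subset_P_of_OWFExist (hIL h)

/-- **`BitCommitmentExist` implies Cook's `P ≠ NP`** (summit shape), modulo the named fact
`OWFExist_of_bitCommitmentExist` (Impagliazzo–Luby 1989, Thm. 1), via `pneNP_shape_of_OWFExist`;
so `BitCommitmentExist` is likewise an open conjecture kept as an undischarged hypothesis.
[cite: ImpagliazzoLuby1989, Thm. 1] -/
theorem pneNP_shape_of_bitCommitmentExist_of (hIL : OWFExist_of_bitCommitmentExist)
    (h : BitCommitmentExist) :
    ∃ L : Language Bool, L ∈ Literature.Computability.Complexity.PNPWave0.NP Bool ∧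
      L ∉ Literature.Computability.Complexity.PNPWave0.P Bool :=
  pneNP_shape_of_OWFExist (hIL h)

/-! ### Signatures (`SecureSignaturesExist`) -/

/-- **`SecureSignaturesExist` implies `NP ⊄ P`**, modulo the named fact
`OWFExist_of_secureSignaturesExist` (the easy direction of Goldreich 2004, Thm. 6.4.1 "Secure
signature schemes exist if and only if one-way functions exist"; Rompel 1990, §1), via the tree's
proved `NP_not_subset_P_of_OWFExist`. [cite: Goldreich2004, Thm. 6.4.1] -/
theorem NP_not_subset_P_of_secureSignaturesExist_of (hIL : OWFExist_of_secureSignaturesExist)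
    (h : SecureSignaturesExist) : ¬ (NP ⊆ P) :=
  NP_not_subset_P_of_OWFExist (hIL h)

/-- **`SecureSignaturesExist` implies Cook's `P ≠ NP`** (summit shape), modulo the named fact
`OWFExist_of_secureSignaturesExist` (Goldreich 2004, Thm. 6.4.1, easy direction), via
`pneNP_shape_of_OWFExist`; so `SecureSignaturesExist` is likewise an open conjecture kept as an
undischarged hypothesis. [cite: Goldreich2004, Thm. 6.4.1] -/
theorem pneNP_shape_of_secureSignaturesExist_of (hIL : OWFExist_of_secureSignaturesExist)
    (h : SecureSignaturesExist) :
    ∃ L : Language Bool, L ∈ Literature.Computability.Complexity.PNPWave0.NP Bool ∧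
      L ∉ Literature.Computability.Complexity.PNPWave0.P Bool :=
  pneNP_shape_of_OWFExist (hIL h)

end Literature.Computability.Cryptography
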